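import Mathlib.FieldTheory.AlgebraicClosure
import Mathlib.FieldTheory.Galois.Infinite
import Mathlib.FieldTheory.IsAlgClosed.Classification
import Mathlib.RingTheory.AlgebraicIndependent.TranscendenceBasis
import Mathlib.RingTheory.AlgebraicIndependent.Transcendental
import Mathlib.RingTheory.Algebraic.Integral
import Mathlib.RingTheory.RootsOfUnity.AlgebraicallyClosed
import Mathlib.Analysis.Complex.Polynomial.Basic
import Mathlib.Analysis.SpecialFunctions.Complex.Circle
import Literature.ModelTheory.ExponentialFields.DefinableAlgebraicNumbers
import Literature.NumberTheory.Transcendental.GammaFieldsEcl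
import Literature.NumberTheory.Transcendental.ZilberFieldHomogeneity
import HarnessLib

/-!
# KMO 2012, §3.7: non-real-abelian algebraic numbers are moved — from the §3.5 Proposition

J. Kirby, A. Macintyre, A. Onshuus, *The algebraic numbers definable in various exponential
fields*, J. Inst. Math. Jussieu 11 (2012) 825–834 (arXiv:1101.4224), §3.7 (proof of Theorem 2).

Sibling PROOF file of `DefinableAlgebraicNumbers.lean`. That file vendors two named facts of the
paper: the "key structural property of Zilber fields", §3.5 Proposition
(`KMO2012_automorphismExtension`: automorphisms of finitely generated, strongly embedded partial
E-subfields containing `SK` extend to the Zilber field), and the automorphism form of Theorem 2,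
§3.7–3.8 (`KMO2012_exists_equiv_apply_ne`: every algebraic number of a Zilber field which is not
real abelian is moved by an automorphism of the exponential field). In the paper the second is
*deduced* from the first (§3.7); this file formalizes that deduction, in every universe:

* `Literature.ModelTheory.ExponentialFields.KMO2012_exists_equiv_apply_ne_of_automorphismExtension :
    KMO2012_automorphismExtension.{u} → KMO2012_exists_equiv_apply_ne.{u}` (**proved**).

Thus the only unproved ingredient of `KMO2012_exists_equiv_apply_ne` left in the tree is the
§3.5 Proposition itself (quasiminimal excellence of Zilber fields, Kirby 2010 Thm 3.3), exactly as
in the source. No named fact is introduced here.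

## The printed proof and its rendering (§3.7, p. 7 of the arXiv version)

Let `F` be a Zilber field (with CCP), `ker exp = τℤ`, `U = exp(ℚτ)` the roots of unity,
`SK = ℚ^{ab}(τ) = ℚ(τ, U)` with `D(SK) = ℚτ`, and `α ∈ ℚ̄ ∖ ℚ^{abℝ}`.

* *Case `α ∈ ℚ^{ab}`.* KMO: "We define an automorphism `σ₁` of `SK` by `σ₁(2πi) = -2πi` … which
  restricts to `σ₀` on `ℚ^{ab}`. Since `SK ◁ F`, the Proposition allows us to extend `σ₁` to an
  automorphism of `F`. Now if `α ∈ ℚ^{ab} ∖ ℚ^{abℝ}` then `σ₀(α) ≠ α`." Here: complex conjugation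
  is transported to the relative algebraic closure `ℚ̄_F` of `ℚ` in `F` along `ℚ̄_F ≅ ℚ̄_ℂ`
  (`KMO2012.exists_algEquiv_apply_eq_inv`: an automorphism `σ₀` of `ℚ̄_F` inverting all roots of
  unity) and extended to a *field* automorphism `ψ` of the algebraically closed field `F` with
  `ψ τ = -τ` through a transcendence basis of `F/ℚ̄_F` containing `τ`
  (`KMO2012.exists_ringEquiv_extend`); `ψ` restricts to KMO's `σ₁` on `F₀ = SK(ᾱ)` (`ᾱ` the
  conjugates of `α`), to which the Proposition is applied
  (`KMO2012.exists_equiv_apply_eq_of_ringEquiv`). That `σ₀ α ≠ α` for `α ∈ ℚ^{ab} ∖ ℚ^{abℝ}`, with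
  the tree's rendering `IsRealAbelian α :⟺ α ∈ ℚ(ζ + ζ⁻¹)` for a root of unity `ζ`, is
  `KMO2012.isRealAbelian_of_apply_eq`: an element of `ℚ(U)` fixed by an automorphism inverting
  the roots of unity lies in some `ℚ(ε + ε⁻¹)` (`α = Σ cₖ εᵏ`, `2α = Σ cₖ (εᵏ + ε⁻ᵏ)`).
* *Case `α ∉ ℚ^{ab}`.* KMO: "Let `F₀ = SK(α)`, with `D(F₀) = D(SK)`. Then, since `α` is algebraic
  over `SK` but not in `SK`, there is an automorphism `σ₂` of `F₀` which fixes `SK` pointwise, but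
  does not fix `α`. Since `F₀` is an algebraic extension of `SK` and the domain of exponentiation
  does not extend, the property `SK ◁ F` implies immediately that `F₀ ◁ F`. Thus `σ₂` extends".
  (As printed this needs `F₀ ⊇` the normal closure of `SK(α)/SK`; we use `F₀ = SK(ᾱ)`.) Here:
  `σ₂` comes from the Galois theory of `ℚ̄_F / ℚ(U)` (`KMO2012.exists_algEquiv_apply_ne`, Mathlib's
  `InfiniteGalois.fixedField_fixingSubgroup`), is extended to a field automorphism of `F` fixing
  `τ`, and restricted to `SK(ᾱ)`.
* *`SK(ᾱ) ◁ F`* (KMO §3.2: "The Schanuel condition then implies that `SK ◁ F`"):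
  `KMO2012.natCast_finrank_le_trdeg_adjoin`, in the `Algebra.trdeg` rendering of strong
  embeddedness used by `KMO2012_automorphismExtension`, from the tree's `SchanuelProperty` through
  the algebraic matroid (`GammaField.toENat_trdeg_adjoin_eq_relRank`,
  `ZilberHomogeneity.natCast_le_eRk_of_le_trdeg`, `Matroid.relRank_add_relRank'`).

The uncountable case needs nothing more here: `KMO2012_automorphismExtension` is stated (as
printed) for all Zilber fields with CCP, which the tree's `IsZilberField` includes.

## Design notes

* The `ℚ`-algebra structure of `↥S` for `S : IntermediateField ℚ F` has two instance paths in
  Mathlib, `IntermediateField.algebra'` (the one inside every Mathlib instance about such `S`,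
  these being generic in the base field) and `DivisionRing.toRatAlgebra ↥S` (available as soon as
  `CharZero ↥S` is, e.g. through `IntermediateField.charZero`); they are equal but not reducibly,
  and with the present imports instance resolution finds the latter first, so the Mathlib
  instances `algebraicClosure.isAlgebraic` / `algebraicClosure.isAlgClosure` are not found by
  resolution. They are supplied by hand (`haveI := algebraicClosure.isAlgClosure ℚ F`, accepted
  by definitional unfolding, the base structure being `DivisionRing.toRatAlgebra F`); no instance
  or attribute is added.
* Why not prove `KMO2012_exists_equiv_apply_ne` outright from the tree's Zilber-field machinery
  (`ZilberPrimeModelIso`, `CountableZilberIso`, `ZilberClassHomogeneity`,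
  `ClassCategoricity.exists_equiv_extend_bases`)? That machinery lives in `Type` (the class
  `ZilberClass` is indexed by pointed E-fields in `Type`), while the fact quantifies over
  `F : Type u`; and the second case would in addition need Γ-isomorphisms realising Galois
  conjugation of algebraic points, which the tree does not have. The present file is the faithful
  rendering of the published proof.

## References

* J. Kirby, A. Macintyre, A. Onshuus, J. Inst. Math. Jussieu 11 (2012) 825–834, arXiv:1101.4224:
  §2.1 (`σ₀`, `ℚ^{abℝ}`), §3.2 (`SK ◁ F`), §3.5 (Proposition), §3.7 (proof of Theorem 2).
* J. Kirby, *On quasiminimal excellent classes*, J. Symbolic Logic 75 (2010) 551–564, Thm 3.3.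
-/

noncomputable section

open scoped Cardinal

universe u

namespace Literature.ModelTheory.ExponentialFields

open Literature.NumberTheory.Transcendental

-- The `ℚ`-algebra structure of an intermediate field `S : IntermediateField ℚ F` has two
-- instance paths, `IntermediateField.algebra'` (used in all Mathlib statements, which are generic
-- in the base field) and `DivisionRing.toRatAlgebra ↥S`; which one instance resolution finds
-- first depends on the import order. We pin Mathlib's choice locally (no new instance).

namespace KMO2012

section FieldAut

variable {F : Type u} [Field F] [CharZero F]

/-- **Extending automorphisms of `ℚ̄ ⊆ F` to field automorphisms of an algebraically closed `F`
with a prescribed sign on a transcendental `τ`.** If `F` is algebraically closed, `ρ` is a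
`ℚ`-automorphism of the relative algebraic closure `ℚ̄_F` of `ℚ` in `F`, `τ ∈ F` is transcendental
and `ε = ±1`, there is a field automorphism `ψ` of `F` with `ψ|ℚ̄_F = ρ` and `ψ τ = ε τ`: extend
`{τ}` to a transcendence basis `t` of `F/ℚ̄_F`, act on `ℚ̄_F[t]` by `ρ` on coefficients and
`X_τ ↦ ε X_τ`, and extend to the algebraic closure `F` of `ℚ̄_F[t]` (Mathlib
`IsAlgClosure.equivOfEquiv`). [folklore] -/
theorem exists_ringEquiv_extend [IsAlgClosed F]
    (ρ : algebraicClosure ℚ F ≃ₐ[ℚ] algebraicClosure ℚ F) {τ : F} (hτ : Transcendental ℚ τ)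
    {ε : ℚ} (hε : ε * ε = 1) :
    ∃ ψ : F ≃+* F, (∀ e : algebraicClosure ℚ F, ψ e = ρ e) ∧ ψ τ = algebraMap ℚ F ε * τ := by
  classical
  haveI : Algebra.IsAlgebraic ℚ (algebraicClosure ℚ F) := algebraicClosure.isAlgebraic ℚ F
  have hτE : Transcendental (algebraicClosure ℚ F) τ := hτ.extendScalars (algebraicClosure ℚ F)
  have hind : AlgebraicIndepOn (algebraicClosure ℚ F) _root_.id ({τ} : Set F) := by
    rw [AlgebraicIndepOn,
      algebraicIndependent_singleton_iff (⟨τ, Set.mem_singleton τ⟩ : ({τ} : Set F))]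
    exact hτE
  obtain ⟨t, hτt, ht⟩ := exists_isTranscendenceBasis_superset hind
  have hτt' : τ ∈ t := hτt (Set.mem_singleton τ)
  haveI : IsAlgClosure (Algebra.adjoin (algebraicClosure ℚ F) (Set.range ((↑) : t → F))) F :=
    IsAlgClosed.isAlgClosure_of_transcendence_basis _ ht
  have hεE : algebraMap ℚ (algebraicClosure ℚ F) ε * algebraMap ℚ (algebraicClosure ℚ F) ε = 1 := by
    rw [← map_mul, hε, map_one]
  have hεF : algebraMap (algebraicClosure ℚ F) F (algebraMap ℚ (algebraicClosure ℚ F) ε) =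
      algebraMap ℚ F ε :=
    (IsScalarTower.algebraMap_apply ℚ (algebraicClosure ℚ F) F ε).symm
  -- the automorphism `X_τ ↦ ε X_τ` of `ℚ̄_F[t]`, twisted by `ρ` on the coefficients
  let i₀ : t := ⟨τ, hτt'⟩
  let g : MvPolynomial t (algebraicClosure ℚ F) →ₐ[algebraicClosure ℚ F]
      MvPolynomial t (algebraicClosure ℚ F) :=
    MvPolynomial.aeval fun i => if i = i₀ then
      MvPolynomial.C (algebraMap ℚ (algebraicClosure ℚ F) ε) * MvPolynomial.X i else MvPolynomial.X i
  have hgX : ∀ i : t, g (MvPolynomial.X i) = if i = i₀ then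
      MvPolynomial.C (algebraMap ℚ (algebraicClosure ℚ F) ε) * MvPolynomial.X i else MvPolynomial.X i :=
    fun i => by simp only [g, MvPolynomial.aeval_X]
  have hgC : ∀ c, g (MvPolynomial.C c) = MvPolynomial.C c := fun c => by
    rw [MvPolynomial.algHom_C, MvPolynomial.algebraMap_eq]
  have hgg : g.comp g = AlgHom.id (algebraicClosure ℚ F) _ := by
    refine MvPolynomial.algHom_ext fun i => ?_
    rw [AlgHom.comp_apply, AlgHom.id_apply, hgX]
    split_ifs with hi
    · rw [map_mul, hgC, hgX, if_pos hi, ← mul_assoc, ← MvPolynomial.C_mul, hεE,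
        MvPolynomial.C_1, one_mul]
    · rw [hgX, if_neg hi]
  let θ₂ : MvPolynomial t (algebraicClosure ℚ F) ≃ₐ[algebraicClosure ℚ F]
      MvPolynomial t (algebraicClosure ℚ F) := AlgEquiv.ofAlgHom g g hgg hgg
  let θ₁ : MvPolynomial t (algebraicClosure ℚ F) ≃+* MvPolynomial t (algebraicClosure ℚ F) :=
    MvPolynomial.mapEquiv t ρ.toRingEquiv
  let θ : Algebra.adjoin (algebraicClosure ℚ F) (Set.range ((↑) : t → F)) ≃+*
      Algebra.adjoin (algebraicClosure ℚ F) (Set.range ((↑) : t → F)) :=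
    ht.1.aevalEquiv.symm.toRingEquiv.trans ((θ₁.trans θ₂.toRingEquiv).trans
      ht.1.aevalEquiv.toRingEquiv)
  have hθ : ∀ p, θ (ht.1.aevalEquiv p) = ht.1.aevalEquiv (θ₂ (θ₁ p)) := fun p => by
    simp only [θ, RingEquiv.trans_apply, AlgEquiv.coe_ringEquiv, AlgEquiv.symm_apply_apply]
  have hθ₂ : ∀ p, θ₂ p = g p := fun p => rfl
  refine ⟨IsAlgClosure.equivOfEquiv F F θ, fun e => ?_, ?_⟩
  · have h1 : algebraMap _ F (algebraMap (algebraicClosure ℚ F)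
        (Algebra.adjoin (algebraicClosure ℚ F) (Set.range ((↑) : t → F))) e) = (e : F) :=
      (IsScalarTower.algebraMap_apply (algebraicClosure ℚ F) _ F e).symm
    have h2 : ∀ c : algebraicClosure ℚ F, algebraMap (algebraicClosure ℚ F)
        (Algebra.adjoin (algebraicClosure ℚ F) (Set.range ((↑) : t → F))) c =
          ht.1.aevalEquiv (MvPolynomial.C c) := fun c => by
      rw [← MvPolynomial.algebraMap_eq, AlgEquiv.commutes]
    have e1 : θ₁ (MvPolynomial.C e) = MvPolynomial.C (ρ e) := by
      simp only [θ₁, MvPolynomial.mapEquiv_apply, MvPolynomial.map_C]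
      rfl
    calc IsAlgClosure.equivOfEquiv F F θ e
        = IsAlgClosure.equivOfEquiv F F θ (algebraMap _ F (algebraMap (algebraicClosure ℚ F)
            (Algebra.adjoin (algebraicClosure ℚ F) (Set.range ((↑) : t → F))) e)) := by rw [h1]
      _ = algebraMap _ F (θ (algebraMap (algebraicClosure ℚ F)
            (Algebra.adjoin (algebraicClosure ℚ F) (Set.range ((↑) : t → F))) e)) :=
          IsAlgClosure.equivOfEquiv_algebraMap F F θ _
      _ = algebraMap _ F (algebraMap (algebraicClosure ℚ F)
            (Algebra.adjoin (algebraicClosure ℚ F) (Set.range ((↑) : t → F))) (ρ e)) := by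
          rw [h2, hθ, e1, hθ₂, hgC, ← h2]
      _ = ((ρ e : algebraicClosure ℚ F) : F) :=
          (IsScalarTower.algebraMap_apply (algebraicClosure ℚ F) _ F (ρ e)).symm
  · have h1 : algebraMap _ F (ht.1.aevalEquiv (MvPolynomial.X i₀)) = τ := by
      rw [AlgebraicIndependent.algebraMap_aevalEquiv, MvPolynomial.aeval_X]
    have e1 : θ₁ (MvPolynomial.X i₀) = MvPolynomial.X i₀ := by
      simp only [θ₁, MvPolynomial.mapEquiv_apply, MvPolynomial.map_X]
    calc IsAlgClosure.equivOfEquiv F F θ τ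
        = IsAlgClosure.equivOfEquiv F F θ (algebraMap _ F (ht.1.aevalEquiv (MvPolynomial.X i₀))) := by
          rw [h1]
      _ = algebraMap _ F (θ (ht.1.aevalEquiv (MvPolynomial.X i₀))) :=
          IsAlgClosure.equivOfEquiv_algebraMap F F θ _
      _ = algebraMap _ F (ht.1.aevalEquiv (g (MvPolynomial.X i₀))) := by rw [hθ, e1, hθ₂]
      _ = algebraMap ℚ F ε * τ := by
          rw [hgX, if_pos rfl, AlgebraicIndependent.algebraMap_aevalEquiv, map_mul,
            MvPolynomial.aeval_C, MvPolynomial.aeval_X, hεF]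

end FieldAut

section Conj

variable {F : Type u} [Field F] [CharZero F]

/-- **An automorphism of `ℚ̄` inverting all roots of unity** (KMO 2012, §2.1: the involution
`σ₀` of `ℚ^{ab}`, which "comes from complex conjugation"; here lifted to the relative algebraic
closure `ℚ̄_F` of `ℚ` in an algebraically closed `F` by transport of complex conjugation along
`ℚ̄_F ≅ ℚ̄_ℂ`). [cite: KirbyMacintyreOnshuus2012, §2.1] -/
theorem exists_algEquiv_apply_eq_inv [IsAlgClosed F] :
    ∃ σ₀ : algebraicClosure ℚ F ≃ₐ[ℚ] algebraicClosure ℚ F,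
      ∀ (ζ : algebraicClosure ℚ F) (n : ℕ), 0 < n → ζ ^ n = 1 → σ₀ ζ = ζ⁻¹ := by
  haveI : IsAlgClosure ℚ (algebraicClosure ℚ ℂ) := algebraicClosure.isAlgClosure ℚ ℂ
  haveI : IsAlgClosure ℚ (algebraicClosure ℚ F) := algebraicClosure.isAlgClosure ℚ F
  let e : algebraicClosure ℚ F ≃ₐ[ℚ] algebraicClosure ℚ ℂ := IsAlgClosure.equiv ℚ _ _
  -- complex conjugation as a `ℚ`-algebra automorphism of `ℂ`, restricted to `ℚ̄_ℂ`
  let cℂ : ℂ ≃ₐ[ℚ] ℂ := AlgEquiv.ofRingEquiv (f := Complex.conjAe.toRingEquiv) fun q => by simp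
  let c : algebraicClosure ℚ ℂ ≃ₐ[ℚ] algebraicClosure ℚ ℂ := algebraicClosure.algEquivOfAlgEquiv cℂ
  have hc : ∀ x : algebraicClosure ℚ ℂ, ((c x : algebraicClosure ℚ ℂ) : ℂ) = (starRingEnd ℂ) x :=
    fun x => rfl
  refine ⟨e.trans (c.trans e.symm), fun ζ n hn hζ => ?_⟩
  have h1 : (e ζ) ^ n = 1 := by rw [← map_pow, hζ, map_one]
  have h2 : ((e ζ : algebraicClosure ℚ ℂ) : ℂ) ^ n = 1 := by
    rw [← SubmonoidClass.coe_pow, h1]; rfl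
  have hnorm : ‖((e ζ : algebraicClosure ℚ ℂ) : ℂ)‖ = 1 := Complex.norm_eq_one_of_pow_eq_one h2 hn.ne'
  have h3 : c (e ζ) = (e ζ)⁻¹ := by
    apply Subtype.ext
    rw [hc]
    have hz0 : ((e ζ : algebraicClosure ℚ ℂ) : ℂ) ≠ 0 := fun h => by simp [h] at hnorm
    have hmul : ((e ζ : algebraicClosure ℚ ℂ) : ℂ) * (starRingEnd ℂ) ((e ζ : algebraicClosure ℚ ℂ) : ℂ) = 1 := by
      rw [Complex.mul_conj, Complex.normSq_eq_norm_sq, hnorm]; simp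
    rw [eq_inv_of_mul_eq_one_right hmul]
    rfl
  rw [AlgEquiv.trans_apply, AlgEquiv.trans_apply, h3, map_inv₀, AlgEquiv.symm_apply_apply]

end Conj

section Galois

variable {F : Type u} [Field F] [CharZero F]

/-- **Galois theory of `ℚ̄/ℚ(U)`**: an element of `ℚ̄_F` outside the field `ℚ(U)` generated by the
roots of unity `U` is moved by some automorphism of `ℚ̄_F` fixing all roots of unity (the fixed
field of `Gal(ℚ̄/ℚ(U))` is `ℚ(U)`, Mathlib `InfiniteGalois.fixedField_fixingSubgroup`). This
replaces the sentence "since `α` is algebraic over `SK` but not in `SK`, there is an automorphism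
`σ₂` of `F₀` which fixes `SK` pointwise, but does not fix `α`" of KMO §3.7.
[cite: KirbyMacintyreOnshuus2012, §3.7] -/
theorem exists_algEquiv_apply_ne [IsAlgClosed F] (a : algebraicClosure ℚ F)
    (ha : a ∉ IntermediateField.adjoin ℚ
      {ζ : algebraicClosure ℚ F | ∃ n : ℕ, 0 < n ∧ ζ ^ n = 1}) :
    ∃ ρ : algebraicClosure ℚ F ≃ₐ[ℚ] algebraicClosure ℚ F,
      (∀ (ζ : algebraicClosure ℚ F) (n : ℕ), 0 < n → ζ ^ n = 1 → ρ ζ = ζ) ∧ ρ a ≠ a := by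
  haveI : Algebra.IsAlgebraic ℚ (algebraicClosure ℚ F) := algebraicClosure.isAlgebraic ℚ F
  haveI : IsAlgClosure ℚ (algebraicClosure ℚ F) := algebraicClosure.isAlgClosure ℚ F
  haveI : IsGalois ℚ (algebraicClosure ℚ F) := isGalois_iff.2 ⟨inferInstance, inferInstance⟩
  by_contra! h
  apply ha
  rw [← InfiniteGalois.fixedField_fixingSubgroup (IntermediateField.adjoin ℚ
    {ζ : algebraicClosure ℚ F | ∃ n : ℕ, 0 < n ∧ ζ ^ n = 1}), IntermediateField.mem_fixedField_iff]
  intro f hf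
  rw [IntermediateField.mem_fixingSubgroup_iff] at hf
  exact h f fun ζ n hn hζ => hf ζ (IntermediateField.subset_adjoin ℚ _ ⟨n, hn, hζ⟩)

end Galois

section RealAbelian

variable {F : Type*} [Field F] [CharZero F]

/-- `ζᵏ + ζ⁻ᵏ ∈ ℚ(ζ + ζ⁻¹)` (Chebyshev recursion
`ζᵏ⁺² + ζ⁻ᵏ⁻² = (ζ + ζ⁻¹)(ζᵏ⁺¹ + ζ⁻ᵏ⁻¹) - (ζᵏ + ζ⁻ᵏ)`). [folklore] -/
theorem pow_add_pow_inv_mem_adjoin {ζ : F} (hζ : ζ ≠ 0) (k : ℕ) :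
    ζ ^ k + (ζ ^ k)⁻¹ ∈ IntermediateField.adjoin ℚ ({ζ + ζ⁻¹} : Set F) := by
  induction k using Nat.twoStepInduction with
  | zero => simpa using add_mem (one_mem _) (one_mem _)
  | one => simpa using IntermediateField.mem_adjoin_simple_self ℚ (ζ + ζ⁻¹)
  | more n h0 h1 =>
    have key : ζ ^ (n + 2) + (ζ ^ (n + 2))⁻¹ =
        (ζ + ζ⁻¹) * (ζ ^ (n + 1) + (ζ ^ (n + 1))⁻¹) - (ζ ^ n + (ζ ^ n)⁻¹) := by
      field_simp
      ring
    rw [key]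
    exact sub_mem (mul_mem (IntermediateField.mem_adjoin_simple_self ℚ _) h1) h0

/-- **Fixed points of `σ₀` in `ℚ(U)` are real abelian** (KMO §2.1: `ℚ^{abℝ} = Fix(σ₀)`, for the
tree's rendering `IsRealAbelian`): if a ring endomorphism `ψ` of an algebraically closed field
`F` of characteristic zero inverts every root of unity, then every element of `ℚ(U)` fixed by `ψ`
lies in `ℚ(ε + ε⁻¹)` for some root of unity `ε` — writing `a = Σ cₖ εᵏ ∈ ℚ(ε)`,
`2a = a + ψ a = Σ cₖ (εᵏ + ε⁻ᵏ)`. [cite: KirbyMacintyreOnshuus2012, §2.1] -/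
theorem isRealAbelian_of_apply_eq [IsAlgClosed F] (ψ : F →+* F)
    (hψ : ∀ (ζ : F) (n : ℕ), 0 < n → ζ ^ n = 1 → ψ ζ = ζ⁻¹) {a : F}
    (ha : a ∈ IntermediateField.adjoin ℚ {ζ : F | ∃ n : ℕ, 0 < n ∧ ζ ^ n = 1})
    (hfix : ψ a = a) : IsRealAbelian a := by
  classical
  obtain ⟨T, hTU, haT⟩ := IntermediateField.exists_finset_of_mem_adjoin ha
  -- a common order `N` of the finitely many roots of unity in `T`
  have hord : ∀ t : T, ∃ n : ℕ, 0 < n ∧ (t : F) ^ n = 1 := fun t => hTU t.2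
  choose n hn0 hn1 using hord
  set N : ℕ := ∏ t : T, n t with hN
  have hNpos : 0 < N := Finset.prod_pos fun t _ => hn0 t
  have hTN : ∀ t : T, (t : F) ^ N = 1 := fun t => by
    obtain ⟨m, hm⟩ : n t ∣ N := Finset.dvd_prod_of_mem n (Finset.mem_univ t)
    rw [hm, pow_mul, hn1, one_pow]
  -- a primitive `N`-th root of unity `ε`; `T ⊆ ℚ(ε)`
  haveI : NeZero N := ⟨hNpos.ne'⟩
  obtain ⟨ε, hε⟩ := HasEnoughRootsOfUnity.exists_primitiveRoot F N
  have hε0 : ε ≠ 0 := hε.ne_zero hNpos.ne'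
  have hεN : ε ^ N = 1 := hε.pow_eq_one
  have hTε : (T : Set F) ⊆ IntermediateField.adjoin ℚ ({ε} : Set F) := by
    intro t ht
    obtain ⟨i, -, hi⟩ := hε.eq_pow_of_pow_eq_one (hTN ⟨t, ht⟩)
    have hi' : ε ^ i = t := hi
    rw [← hi']
    exact pow_mem (IntermediateField.mem_adjoin_simple_self ℚ ε) i
  have haε : a ∈ IntermediateField.adjoin ℚ ({ε} : Set F) :=
    (IntermediateField.adjoin_le_iff.2 hTε) haT
  -- `a` is a polynomial in `ε`
  have hεint : IsIntegral ℚ ε := IsIntegral.of_pow hNpos (by rw [hεN]; exact isIntegral_one)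
  have haε' : a ∈ (IntermediateField.adjoin ℚ ({ε} : Set F)).toSubalgebra := haε
  rw [IntermediateField.adjoin_simple_toSubalgebra_of_isAlgebraic hεint.isAlgebraic,
    Algebra.adjoin_singleton_eq_range_aeval] at haε'
  obtain ⟨f, hf⟩ := haε'
  change Polynomial.aeval ε f = a at hf
  -- `2a = Σ cₖ (εᵏ + ε⁻ᵏ) ∈ ℚ(ε + ε⁻¹)`
  have hψε : ψ ε = ε⁻¹ := hψ ε N hNpos hεN
  have hsum : a + ψ a = ∑ k ∈ Finset.range (f.natDegree + 1),
      f.coeff k • (ε ^ k + (ε ^ k)⁻¹) := by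
    rw [← hf, Polynomial.aeval_eq_sum_range, map_sum, ← Finset.sum_add_distrib]
    refine Finset.sum_congr rfl fun k _ => ?_
    rw [smul_add, map_rat_smul, map_pow, hψε, inv_pow]
  have hmem : a + ψ a ∈ IntermediateField.adjoin ℚ ({ε + ε⁻¹} : Set F) := by
    rw [hsum]
    refine sum_mem fun k _ => ?_
    exact IntermediateField.smul_mem _ (pow_add_pow_inv_mem_adjoin hε0 k)
  rw [hfix, ← two_smul ℚ a] at hmem
  have ha2 : a = (2 : ℚ)⁻¹ • ((2 : ℚ) • a) := by
    rw [smul_smul, inv_mul_cancel₀ two_ne_zero, one_smul]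
  refine ⟨ε, ⟨N, hNpos, hεN⟩, ?_⟩
  rw [ha2]
  exact IntermediateField.smul_mem _ hmem

end RealAbelian

section Strong

open Literature.ModelTheory.ExponentialFields.ExponentialRing Matroid
  Literature.NumberTheory.Transcendental.GammaField

variable {F : Type u} [Field F] [CharZero F] [ExponentialRing F]

/-- **`SK(ᾱ) ◁ F` from the Schanuel property** (KMO §3.2: "The Schanuel condition then implies
that `SK ◁ F`"; §3.7: "Since `F₀` is an algebraic extension of `SK` and the domain of
exponentiation does not extend, the property `SK ◁ F` implies immediately that `F₀ ◁ F`"), in the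
rendering of `KMO2012_automorphismExtension`: if `F` has the Schanuel property, `τ ≠ 0`,
`exp τ = 1`, and `F₀ ∋ τ` is a subfield algebraic over `ℚ(τ)`, then for every finite `Y ⊆ F`,
`ldim_ℚ(Y/ℚτ) ≤ td(Y, exp Y/F₀)`. Proof: if `y₁, …, yₘ ∈ Y` have `ℚ`-linearly independent images
modulo `ℚτ`, then `τ, y₁, …, yₘ` are `ℚ`-linearly independent, so `td_ℚ(τ, ȳ, exp ȳ) ≥ m + 1` by
the Schanuel property, and passing to the base `F₀ ⊆ acl(τ)` costs at most `1`.
[cite: KirbyMacintyreOnshuus2012, §3.2 and §3.7] -/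
theorem natCast_finrank_le_trdeg_adjoin (hSP : SchanuelProperty F) {τ : F} (hτ0 : τ ≠ 0)
    (hexpτ : exp τ = 1) (F₀ : IntermediateField ℚ F) (hτF₀ : τ ∈ F₀)
    (hF₀ : (F₀ : Set F) ⊆ acl ({τ} : Set F)) (Y : Finset F) :
    (Module.finrank ℚ ↥((Submodule.span ℚ (Y : Set F)).map (Submodule.span ℚ ({τ} : Set F)).mkQ)
        : Cardinal) ≤
      Algebra.trdeg F₀ ↥(IntermediateField.adjoin F₀ ((Y : Set F) ∪ exp '' (Y : Set F))) := by
  classical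
  set D : Submodule ℚ F := Submodule.span ℚ ({τ} : Set F) with hD
  have hτD : τ ∈ D := Submodule.subset_span (Set.mem_singleton τ)
  -- a maximal subfamily of `Y` linearly independent modulo `D`
  obtain ⟨κ, ι, hιinj, hspan, hli⟩ :=
    exists_linearIndependent' ℚ (fun y : (Y : Set F) => D.mkQ (y : F))
  haveI : Fintype κ := Fintype.ofInjective ι hιinj
  set k := Fintype.card κ with hk
  have hfinrank : Module.finrank ℚ ↥((Submodule.span ℚ (Y : Set F)).map D.mkQ) = k := by
    have h1 : (Submodule.span ℚ (Y : Set F)).map D.mkQ =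
        Submodule.span ℚ (Set.range ((fun y : (Y : Set F) => D.mkQ (y : F)) ∘ ι)) := by
      rw [hspan, Submodule.map_span, Set.image_eq_range]
    rw [h1, finrank_span_eq_card hli]
  rw [hfinrank]
  -- the tuple `(τ, y_{ι 1}, …, y_{ι k})` is `ℚ`-linearly independent
  set e : Fin k ≃ κ := (Fintype.equivFin κ).symm with he
  set y : Fin k → F := fun i => ((ι (e i) : (Y : Set F)) : F) with hy
  have hyY : ∀ i, y i ∈ (Y : Set F) := fun i => (ι (e i)).2
  have hliq : LinearIndependent ℚ (D.mkQ ∘ y) := by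
    have : D.mkQ ∘ y = ((fun y : (Y : Set F) => D.mkQ (y : F)) ∘ ι) ∘ e := rfl
    rw [this]
    exact hli.comp _ e.injective
  have hz : LinearIndependent ℚ (Fin.cons τ y : Fin (k + 1) → F) := by
    refine LinearIndependent.finCons (LinearIndependent.of_comp D.mkQ hliq) fun hmem => ?_
    obtain ⟨c, hc⟩ := (Submodule.mem_span_range_iff_exists_fun ℚ).1 hmem
    have hc0 : ∀ i, c i = 0 := by
      refine Fintype.linearIndependent_iff.1 hliq c ?_
      have := congrArg D.mkQ hc
      rw [map_sum] at this
      simp only [Function.comp_apply, map_smul] at this ⊢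
      rw [this, Submodule.mkQ_apply, Submodule.Quotient.mk_eq_zero]
      exact hτD
    apply hτ0
    rw [← hc]
    simp [hc0]
  -- Schanuel: `td_ℚ(τ, ȳ, exp τ, exp ȳ) ≥ k + 1`
  have hSch := hSP (k + 1) (Fin.cons τ y) hz
  set S : Set F := Set.range (Fin.cons τ y : Fin (k + 1) → F) ∪
    Set.range (exp ∘ (Fin.cons τ y : Fin (k + 1) → F)) with hS
  have hrk : ((k + 1 : ℕ) : ℕ∞) ≤ (algMatroid F).eRk S :=
    ZilberHomogeneity.natCast_le_eRk_of_le_trdeg (by exact_mod_cast hSch)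
  -- `S ⊆ closure (F₀ ∪ Z)`, `Z = Y ∪ exp Y`
  set Z : Set F := (Y : Set F) ∪ exp '' (Y : Set F) with hZ
  have hSsub : S ⊆ (algMatroid F).closure ((F₀ : Set F) ∪ Z) := by
    rintro b (⟨i, rfl⟩ | ⟨i, rfl⟩)
    · refine (algMatroid F).subset_closure _ (Set.subset_univ _) ?_
      refine Fin.cases ?_ (fun j => ?_) i
      · exact Or.inl hτF₀
      · exact Or.inr (Or.inl (by rw [Fin.cons_succ]; exact hyY j))
    · refine Fin.cases ?_ (fun j => ?_) i
      · simp only [Function.comp_apply, Fin.cons_zero, hexpτ]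
        exact one_mem_acl _
      · refine (algMatroid F).subset_closure _ (Set.subset_univ _) ?_
        exact Or.inr (Or.inr ⟨y j, hyY j, by simp [hy]⟩)
  have hrk' : ((k + 1 : ℕ) : ℕ∞) ≤ (algMatroid F).eRk ((F₀ : Set F) ∪ Z) := by
    refine hrk.trans ?_
    rw [← (algMatroid F).eRk_closure_eq ((F₀ : Set F) ∪ Z)]
    exact (algMatroid F).eRk_mono hSsub
  -- `rk(F₀ ∪ Z) = rk F₀ + relRank F₀ Z` and `rk F₀ ≤ rk {τ} ≤ 1`
  have hadd : (algMatroid F).eRk (F₀ : Set F) + (algMatroid F).relRank (F₀ : Set F) Z =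
      (algMatroid F).eRk ((F₀ : Set F) ∪ Z) := by
    have h := (algMatroid F).relRank_add_relRank' (Set.empty_subset (F₀ : Set F)) Z
    rwa [relRank_eq_eRk_contract, relRank_eq_eRk_contract _ ∅, contract_empty] at h
  have hF₀rk : (algMatroid F).eRk (F₀ : Set F) ≤ 1 := by
    calc (algMatroid F).eRk (F₀ : Set F) ≤ (algMatroid F).eRk ((algMatroid F).closure {τ}) :=
          (algMatroid F).eRk_mono hF₀
      _ = (algMatroid F).eRk {τ} := (algMatroid F).eRk_closure_eq _
      _ ≤ 1 := (algMatroid F).eRk_singleton_le τ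
  have hrel : (k : ℕ∞) ≤ (algMatroid F).relRank (F₀ : Set F) Z := by
    rw [← hadd] at hrk'
    have h1 : ((k + 1 : ℕ) : ℕ∞) ≤ 1 + (algMatroid F).relRank (F₀ : Set F) Z :=
      hrk'.trans (add_le_add hF₀rk le_rfl)
    rw [Nat.cast_add, Nat.cast_one, add_comm (1 : ℕ∞)] at h1
    exact (ENat.add_le_add_iff_right ENat.one_ne_top).1 h1
  -- back to `Algebra.trdeg`
  rw [← toENat_trdeg_adjoin_eq_relRank F₀ Z] at hrel
  have := (Cardinal.enat_gc (k : ℕ∞) _).2 hrel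
  simpa using this

end Strong

section Main

open Literature.ModelTheory.ExponentialFields.ExponentialRing
  Literature.NumberTheory.Transcendental.GammaField

variable {F : Type u} [Field F] [CharZero F] [ExponentialRing F]

/-- `exp (q • τ)` is a root of unity of order dividing `den q` when `exp τ = 1`. [folklore] -/
theorem exp_smul_pow_den {τ : F} (hτ : exp τ = 1) (q : ℚ) : exp (q • τ) ^ q.den = 1 := by
  rw [← exp_nsmul, ← Nat.cast_smul_eq_nsmul ℚ, smul_smul, Rat.den_mul_eq_num,
    Int.cast_smul_eq_zsmul ℚ, exp_zsmul, hτ, one_zpow]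

/-- The generators `{τ, -τ} ∪ R ∪ exp(ℚτ)` of `F₀ = SK(R)` are permuted by a field automorphism
`φ` with `φ τ = ±τ`, `φ (exp (qτ)) = exp (q φ τ)` and `φ R ⊆ R`. [folklore] -/
theorem mapsTo_gens [DecidableEq F] {τ : F} (φ : F ≃+* F) (hφτ : φ τ = τ ∨ φ τ = -τ)
    (hφexp : ∀ q : ℚ, φ (exp (q • τ)) = exp (q • φ τ)) (R : Finset F)
    (hR : ∀ r ∈ R, φ r ∈ R) :
    Set.MapsTo φ
      ((↑(insert τ (insert (-τ) R)) : Set F) ∪ exp '' (Submodule.span ℚ ({τ} : Set F) : Set F))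
      ((↑(insert τ (insert (-τ) R)) : Set F) ∪ exp '' (Submodule.span ℚ ({τ} : Set F) : Set F)) := by
  have hφτmem : φ τ ∈ insert τ (insert (-τ) R) := by
    rcases hφτ with h | h <;> simp [h]
  have hφnegτmem : φ (-τ) ∈ insert τ (insert (-τ) R) := by
    rcases hφτ with h | h <;> simp [map_neg, h]
  rintro g (hg | ⟨x, hx, rfl⟩)
  · left
    rw [Finset.coe_insert, Finset.coe_insert] at hg ⊢
    rcases hg with rfl | rfl | hg
    · exact_mod_cast hφτmem
    · exact_mod_cast hφnegτmem
    · exact Or.inr (Or.inr (hR g hg))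
  · right
    obtain ⟨q, rfl⟩ := Submodule.mem_span_singleton.1 hx
    refine ⟨q • φ τ, ?_, (hφexp q).symm⟩
    refine Submodule.smul_mem _ q ?_
    rcases hφτ with h | h
    · rw [h]; exact Submodule.subset_span (Set.mem_singleton τ)
    · rw [h]; exact Submodule.neg_mem _ (Submodule.subset_span (Set.mem_singleton τ))

/-- **The §3.5 Proposition applied to `F₀ = SK(R)` and the restriction of a global field
automorphism** (KMO §3.7, both cases): let `F` be a Zilber field with kernel generator `τ`, `ψ` a
field automorphism of `F` with `ψ τ = ±τ` and `ψ (exp qτ) = exp (q ψ τ)` (`q ∈ ℚ`), and `R` a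
finite `ψ`-stable set of algebraic numbers. Then `F₀ = ℚ(τ, R, exp ℚτ) = SK(R)` with
`D(F₀) = ℚτ` is a finitely generated partial E-subfield containing `SK`, strongly embedded by
the Schanuel property (`natCast_finrank_le_trdeg_adjoin`), `ψ|F₀` is an automorphism of it, and
`KMO2012_automorphismExtension` provides an automorphism of the exponential field `F` agreeing
with `ψ` on `R`. [cite: KirbyMacintyreOnshuus2012, §3.5 Proposition and §3.7] -/
theorem exists_equiv_apply_eq_of_ringEquiv [DecidableEq F] (h : KMO2012_automorphismExtension.{u})
    (hF : IsZilberField F) {τ : F} (hτ : Transcendental ℚ τ)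
    (hker : expKernel F = AddSubgroup.zmultiples τ) (ψ : F ≃+* F)
    (hψτ : ψ τ = τ ∨ ψ τ = -τ) (hψexp : ∀ q : ℚ, ψ (exp (q • τ)) = exp (q • ψ τ))
    (R : Finset F) (hRalg : ∀ r ∈ R, IsAlgebraic ℚ r) (hR : ∀ r ∈ R, ψ r ∈ R)
    (hR' : ∀ r ∈ R, ψ.symm r ∈ R) :
    ∃ σ : ExponentialRingEquiv F F, ∀ r ∈ R, σ r = ψ r := by
  have hτ0 : τ ≠ 0 := fun h0 => hτ (h0 ▸ isAlgebraic_zero)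
  have hexpτ : exp τ = 1 := by
    rw [← mem_expKernel_iff, hker]; exact AddSubgroup.mem_zmultiples τ
  set D : Submodule ℚ F := Submodule.span ℚ ({τ} : Set F) with hDdef
  have hτD : τ ∈ D := Submodule.subset_span (Set.mem_singleton τ)
  set X : Finset F := insert τ (insert (-τ) R) with hXdef
  set G : Set F := (X : Set F) ∪ exp '' (D : Set F) with hGdef
  set F₀ : IntermediateField ℚ F := IntermediateField.adjoin ℚ G with hF₀def
  have hτX : τ ∈ X := Finset.mem_insert_self τ _
  have hτF₀ : τ ∈ F₀ := IntermediateField.subset_adjoin ℚ G (Or.inl (by exact_mod_cast hτX))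
  -- the hypotheses of the Proposition on `(F₀, D)`
  have hDF₀ : (D : Set F) ⊆ F₀ := by
    intro x hx
    obtain ⟨q, rfl⟩ := Submodule.mem_span_singleton.1 hx
    exact IntermediateField.smul_mem F₀ hτF₀
  have hexpF₀ : ∀ x ∈ D, exp x ∈ F₀ := fun x hx =>
    IntermediateField.subset_adjoin ℚ G (Or.inr ⟨x, hx, rfl⟩)
  have hkerD : ∀ x : F, exp x = 1 → x ∈ D := by
    intro x hx
    have hx' : x ∈ expKernel F := (mem_expKernel_iff x).2 hx
    rw [hker, AddSubgroup.mem_zmultiples_iff] at hx'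
    obtain ⟨k, rfl⟩ := hx'
    rw [← Int.cast_smul_eq_zsmul ℚ]
    exact Submodule.smul_mem D _ hτD
  have hspanX : Submodule.span ℚ ((X : Set F) ∩ (D : Set F)) = D := by
    refine le_antisymm (Submodule.span_le.2 Set.inter_subset_right) ?_
    rw [hDdef]
    refine Submodule.span_mono ?_
    rw [← hDdef]
    exact Set.singleton_subset_iff.2 ⟨by exact_mod_cast hτX, hτD⟩
  have hF₀acl : (F₀ : Set F) ⊆ acl ({τ} : Set F) := by
    refine (adjoin_subset_acl G).trans (acl_subset_acl_of_subset ?_)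
    rintro g (hg | ⟨x, hx, rfl⟩)
    · rw [hXdef, Finset.coe_insert, Finset.coe_insert] at hg
      rcases hg with rfl | rfl | hg
      · exact subset_acl _ (Set.mem_singleton _)
      · exact neg_mem_acl (subset_acl _ (Set.mem_singleton τ))
      · rw [mem_acl_iff]
        exact (hRalg g hg).extendScalars (algebraMap ℚ (Algebra.adjoin ℚ ({τ} : Set F))).injective
    · obtain ⟨q, rfl⟩ := Submodule.mem_span_singleton.1 hx
      refine exp_smul_mem_acl q ?_
      rw [hexpτ]; exact one_mem_acl _
  have hstrong : ∀ Y : Finset F,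
      (Module.finrank ℚ ↥((Submodule.span ℚ (Y : Set F)).map D.mkQ) : Cardinal) ≤
        Algebra.trdeg F₀ ↥(IntermediateField.adjoin F₀
          ((Y : Set F) ∪ exp '' (Y : Set F))) := fun Y =>
    natCast_finrank_le_trdeg_adjoin hF.schanuelProperty hτ0 hexpτ F₀ hτF₀ hF₀acl Y
  -- `ψ` restricts to an automorphism of `F₀`
  let ψₐ : F ≃ₐ[ℚ] F := AlgEquiv.ofRingEquiv (f := ψ) fun q => by simp
  have hψₐ : ∀ x, ψₐ x = ψ x := fun x => rfl
  have hψsymmτ : ψ.symm τ = τ ∨ ψ.symm τ = -τ := by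
    rcases hψτ with h1 | h1
    · left
      conv_lhs => rw [← h1]
      exact ψ.symm_apply_apply τ
    · right
      have h2 : ψ (-τ) = τ := by rw [map_neg, h1, neg_neg]
      conv_lhs => rw [← h2]
      exact ψ.symm_apply_apply (-τ)
  have hψsymmexp : ∀ q : ℚ, ψ.symm (exp (q • τ)) = exp (q • ψ.symm τ) := by
    intro q
    apply ψ.injective
    rw [ψ.apply_symm_apply]
    rcases hψτ with h1 | h1
    · have h2 : ψ.symm τ = τ := by
        conv_lhs => rw [← h1]
        exact ψ.symm_apply_apply τ
      rw [h2, hψexp, h1]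
    · have h2 : ψ.symm τ = -τ := by
        have h3 : ψ (-τ) = τ := by rw [map_neg, h1, neg_neg]
        conv_lhs => rw [← h3]
        exact ψ.symm_apply_apply (-τ)
      rw [h2, smul_neg, ← neg_smul, hψexp, h1, smul_neg, neg_smul, neg_neg]
  have hG : ψ '' G = G := by
    refine Set.Subset.antisymm (mapsTo_gens ψ hψτ hψexp R hR).image_subset fun g hg => ?_
    exact ⟨ψ.symm g, mapsTo_gens ψ.symm hψsymmτ hψsymmexp R hR' hg, ψ.apply_symm_apply g⟩
  have hF₀map : F₀.map ψₐ.toAlgHom = F₀ := by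
    rw [hF₀def, IntermediateField.adjoin_map]
    congr 1
  let σₐ : F₀ ≃ₐ[ℚ] F₀ :=
    (IntermediateField.intermediateFieldMap ψₐ F₀).trans (IntermediateField.equivOfEq hF₀map)
  have hσ : ∀ x : F₀, ((σₐ x : F₀) : F) = ψ x := fun x => rfl
  -- the compatibility of `σ = ψ|F₀` with `(D, exp|D)`
  have hψτD : ψ τ ∈ D := by
    rcases hψτ with h1 | h1
    · rw [h1]; exact hτD
    · rw [h1]; exact Submodule.neg_mem D hτD
  have hσD : ∀ x : F₀, (x : F) ∈ D → ((σₐ.toRingEquiv x : F₀) : F) ∈ D := by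
    intro x hx
    change ((σₐ x : F₀) : F) ∈ D
    rw [hσ]
    obtain ⟨q, hq⟩ := Submodule.mem_span_singleton.1 hx
    rw [← hq, map_rat_smul]
    exact Submodule.smul_mem D q hψτD
  have hσexp : ∀ x y : F₀, (x : F) ∈ D → exp (x : F) = y →
      exp ((σₐ.toRingEquiv x : F₀) : F) = ((σₐ.toRingEquiv y : F₀) : F) := by
    intro x y hx hxy
    change exp ((σₐ x : F₀) : F) = ((σₐ y : F₀) : F)
    rw [hσ, hσ, ← hxy]
    obtain ⟨q, hq⟩ := Submodule.mem_span_singleton.1 hx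
    rw [← hq, map_rat_smul, hψexp]
  obtain ⟨σ', hσ'⟩ := h F hF F₀ D hDF₀ hexpF₀ hkerD ⟨X, hspanX, rfl⟩ hstrong σₐ.toRingEquiv
    hσD hσexp
  refine ⟨σ', fun r hr => ?_⟩
  have hrF₀ : r ∈ F₀ := IntermediateField.subset_adjoin ℚ G (Or.inl (by
    rw [hXdef, Finset.coe_insert, Finset.coe_insert]; exact Or.inr (Or.inr hr)))
  have := hσ' ⟨r, hrF₀⟩
  rw [this]
  exact hσ ⟨r, hrF₀⟩

end Main

section Theorem

open Literature.ModelTheory.ExponentialFields.ExponentialRing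

/-- **KMO 2012, §3.7 from the §3.5 Proposition**: the automorphism argument proving Theorem 2 —
in a Zilber field with CCP every algebraic number which is not real abelian is moved by an
automorphism of the exponential field — granted the extension of automorphisms of finitely
generated strongly embedded partial E-subfields containing `SK` (`KMO2012_automorphismExtension`,
the only ingredient of the printed proof not proved here). The two cases of the printed proof:

* `α ∈ ℚ^{ab} = ℚ(U)`: a field automorphism `ψ` of `F` with `ψ τ = -τ` inverting all roots of
  unity (complex conjugation transported to `ℚ̄_F`, `exists_algEquiv_apply_eq_inv`, extended to `F`
  by `exists_ringEquiv_extend`) restricts to KMO's `σ₁` on `SK(ᾱ)`; its extension `σ` to the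
  exponential field moves `α`, for otherwise `α ∈ Fix(σ₀) ∩ ℚ(U) ⊆ ℚ^{abℝ}`
  (`isRealAbelian_of_apply_eq`);
* `α ∈ ℚ̄ ∖ ℚ^{ab}`: an automorphism of `ℚ̄_F` over `ℚ(U)` moving `α` (`exists_algEquiv_apply_ne`,
  Galois theory; KMO's `σ₂`, taken on the normal closure `SK(ᾱ)` of `SK(α)`), extended to `F`
  fixing `τ`, restricts to an automorphism of `SK(ᾱ) ◁ F` over `SK` and extends to the
  exponential field.
[cite: KirbyMacintyreOnshuus2012, §3.7 (proof of Theorem 2)] -/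
theorem _root_.Literature.ModelTheory.ExponentialFields.KMO2012_exists_equiv_apply_ne_of_automorphismExtension
    (h : KMO2012_automorphismExtension.{u}) : KMO2012_exists_equiv_apply_ne.{u} := by
  intro F _ _ _ hF a ha hna
  classical
  haveI : IsAlgClosed F := hF.isAlgClosed
  obtain ⟨τ, hτ, hker⟩ := hF.hasStandardKernel
  have hexpτ : exp τ = 1 := by
    rw [← mem_expKernel_iff, hker]; exact AddSubgroup.mem_zmultiples τ
  -- the conjugates of `a`
  set p := minpoly ℚ a with hp
  have hp0 : p ≠ 0 := minpoly.ne_zero ha.isIntegral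
  set R : Finset F := (p.rootSet F).toFinset with hR
  have hRmem : ∀ r, r ∈ R ↔ r ∈ p.rootSet F := fun r => by rw [hR, Set.mem_toFinset]
  have haR : a ∈ R := (hRmem a).2 (Polynomial.mem_rootSet.2 ⟨hp0, minpoly.aeval ℚ a⟩)
  have hRalg : ∀ r ∈ R, IsAlgebraic ℚ r := fun r hr => by
    obtain ⟨-, hr2⟩ := Polynomial.mem_rootSet.1 ((hRmem r).1 hr)
    exact ⟨p, hp0, hr2⟩
  have hRstab : ∀ (φ : F ≃+* F), ∀ r ∈ R, φ r ∈ R := fun φ r hr => by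
    rw [hRmem, Polynomial.mem_rootSet] at hr ⊢
    refine ⟨hp0, ?_⟩
    rw [show φ r = (φ : F →+* F).toRatAlgHom r from rfl, Polynomial.aeval_algHom_apply, hr.2,
      map_zero]
  -- roots of unity are algebraic, and `exp (q • τ)` is one
  have hUalg : ∀ (ζ : F) (n : ℕ), 0 < n → ζ ^ n = 1 → ζ ∈ algebraicClosure ℚ F :=
    fun ζ n hn hζ => (mem_algebraicClosure_iff).2
      (IsIntegral.of_pow hn (by rw [hζ]; exact isIntegral_one)).isAlgebraic
  by_cases haU : a ∈ IntermediateField.adjoin ℚ {ζ : F | ∃ n : ℕ, 0 < n ∧ ζ ^ n = 1}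
  · -- Case `a ∈ ℚ(U)`: extend `σ₁ : τ ↦ -τ`
    obtain ⟨σ₀, hσ₀⟩ := KMO2012.exists_algEquiv_apply_eq_inv (F := F)
    obtain ⟨ψ, hψE, hψτ⟩ :=
      KMO2012.exists_ringEquiv_extend σ₀ hτ (ε := -1) (by norm_num)
    have hψτ' : ψ τ = -τ := by rw [hψτ, map_neg, map_one, neg_one_mul]
    have hψU : ∀ (ζ : F) (n : ℕ), 0 < n → ζ ^ n = 1 → ψ ζ = ζ⁻¹ := by
      intro ζ n hn hζ
      have h1 := hψE ⟨ζ, hUalg ζ n hn hζ⟩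
      have h2 : (⟨ζ, hUalg ζ n hn hζ⟩ : algebraicClosure ℚ F) ^ n = 1 := Subtype.ext (by
        rw [SubmonoidClass.coe_pow]; exact hζ)
      rw [show ψ ζ = ψ ((⟨ζ, hUalg ζ n hn hζ⟩ : algebraicClosure ℚ F) : F) from rfl, h1,
        hσ₀ _ n hn h2]
      rfl
    have hψexp : ∀ q : ℚ, ψ (exp (q • τ)) = exp (q • ψ τ) := fun q => by
      rw [hψτ', smul_neg, exp_neg_eq_inv]
      exact hψU _ q.den q.den_pos (KMO2012.exp_smul_pow_den hexpτ q)
    obtain ⟨σ, hσ⟩ := KMO2012.exists_equiv_apply_eq_of_ringEquiv h hF hτ hker ψ (Or.inr hψτ')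
      hψexp R hRalg (hRstab ψ) (hRstab ψ.symm)
    refine ⟨σ, fun hfix => hna ?_⟩
    rw [hσ a haR] at hfix
    exact KMO2012.isRealAbelian_of_apply_eq (ψ : F →+* F) hψU haU hfix
  · -- Case `a ∉ ℚ(U)`: extend an automorphism of `ℚ̄` over `ℚ(U)` moving `a`
    have ha' : a ∈ algebraicClosure ℚ F := (mem_algebraicClosure_iff).2 ha
    have haU' : (⟨a, ha'⟩ : algebraicClosure ℚ F) ∉ IntermediateField.adjoin ℚ
        {ζ : algebraicClosure ℚ F | ∃ n : ℕ, 0 < n ∧ ζ ^ n = 1} := by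
      intro hmem
      apply haU
      let ι : algebraicClosure ℚ F →ₐ[ℚ] F := (algebraMap (algebraicClosure ℚ F) F).toRatAlgHom
      have h1 : a ∈ (IntermediateField.adjoin ℚ
          {ζ : algebraicClosure ℚ F | ∃ n : ℕ, 0 < n ∧ ζ ^ n = 1}).map ι := ⟨⟨a, ha'⟩, hmem, rfl⟩
      rw [IntermediateField.adjoin_map] at h1
      refine IntermediateField.adjoin.mono ℚ _ _ ?_ h1
      rintro _ ⟨ζ, ⟨n, hn, hζ⟩, rfl⟩
      refine ⟨n, hn, ?_⟩
      have := congrArg ι hζ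
      rwa [map_pow, map_one] at this
    obtain ⟨ρ, hρU, hρa⟩ := KMO2012.exists_algEquiv_apply_ne ⟨a, ha'⟩ haU'
    obtain ⟨ψ, hψE, hψτ⟩ := KMO2012.exists_ringEquiv_extend ρ hτ (ε := 1) (by norm_num)
    have hψτ' : ψ τ = τ := by rw [hψτ, map_one, one_mul]
    have hψU : ∀ (ζ : F) (n : ℕ), 0 < n → ζ ^ n = 1 → ψ ζ = ζ := by
      intro ζ n hn hζ
      have h1 := hψE ⟨ζ, hUalg ζ n hn hζ⟩
      have h2 : (⟨ζ, hUalg ζ n hn hζ⟩ : algebraicClosure ℚ F) ^ n = 1 := Subtype.ext (by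
        rw [SubmonoidClass.coe_pow]; exact hζ)
      rw [show ψ ζ = ψ ((⟨ζ, hUalg ζ n hn hζ⟩ : algebraicClosure ℚ F) : F) from rfl, h1,
        hρU _ n hn h2]
    have hψexp : ∀ q : ℚ, ψ (exp (q • τ)) = exp (q • ψ τ) := fun q => by
      rw [hψτ']
      exact hψU _ q.den q.den_pos (KMO2012.exp_smul_pow_den hexpτ q)
    obtain ⟨σ, hσ⟩ := KMO2012.exists_equiv_apply_eq_of_ringEquiv h hF hτ hker ψ (Or.inl hψτ')
      hψexp R hRalg (hRstab ψ) (hRstab ψ.symm)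
    refine ⟨σ, fun hfix => hρa (Subtype.ext ?_)⟩
    rw [hσ a haR] at hfix
    have h1 := hψE ⟨a, ha'⟩
    exact h1.symm.trans hfix

end Theorem

end KMO2012

end Literature.ModelTheory.ExponentialFields
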